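import Mathlib.RingTheory.MvPolynomial.Ideal
import Mathlib.RingTheory.MvPolynomial.Basic
import Mathlib.FieldTheory.Finite.Basic
import HarnessLib

/-!
# Powers of an intersection of monomial ideals: some Veronese is standard (Herzog–Hibi–Trung 2007, Cor. 2.2) — named fact

Topic: `Literature/RingTheory/MvPolynomial`. J. Herzog, T. Hibi, N. V. Trung, *Symbolic powers of monomial
ideals and vertex cover algebras*, Adv. Math. 210 (2007) 304–322 [HerzogHibiTrung2007] (held:
`paper:arxiv-math_0512423`, arXiv math/0512423; numbering checked on the arXiv PDF), §§1–2, verbatim: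

> **Corollary 1.3.** Let `K` be a field, `S = K[x_1, …, x_n]` the polynomial ring over `K` in `n` variables and
> `I_1, …, I_r ⊂ S` monomial ideals. Then the algebra `A = ⊕_{k ≥ 0} (⋂_{j=1}^r I_j^k) t^k` is a finitely
> generated `S`-algebra. [via Thm. 1.1: an affine semigroup `H ⊂ ℤⁿ` with `ℚ₊H` a rational cone is finitely
> generated, and Cor. 1.2: a finite intersection of finitely generated affine semigroups is finitely generated]
>
> §2: "For any positive integer `d` we denote by `A^{(d)} = ⊕_{j ≥ 0} A_{jd}` the `d`th Veronese subalgebra of `A`."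
> **Theorem 2.1.** The following conditions are equivalent: (a) `A` is a finitely generated `S`-algebra. (b) There
> exists an integer `d` such that `A^{(d)}` is a standard graded `S`-algebra. (c) There exists a number `d` such
> that `A^{(d)}` is a finitely generated `S`-algebra.
>
> "As an immediate consequence of Theorem 2.1 and Corollary 1.3 we obtain
> **Corollary 2.2.** Let `I_1, …, I_r ⊂ S` be monomial ideals. Then there exists an integer `d` such that
> `(⋂_{j=1}^r I_j^d)^k = ⋂_{j=1}^r I_j^{dk}` for all `k ≥ 1`."
>
> **Remark 2.4.** "There does not exist a number `d₀` such that `A^{(d)}` is standard graded for all `d ≥ d₀`.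
> Consider for example the ideal `I = (x, y) ∩ (y, z) ∩ (x, z)` … `A^{(2k)}` is standard graded for `k ≥ 1`. …
> Hence `A^{(2k+1)}` is not standard graded for `k ≥ 0`."

(The squarefree case of Cor. 1.3 is Lyubeznik, J. Algebra 112 (1988) 86–89, as the introduction notes; Thm. 3.2
extends finite generation to all symbolic Rees algebras of monomial ideals.) Characteristic-free: `K` is any field.

* `IsMonomial I` — REAL definition: the ideal `I ⊆ R[X_σ]` is generated by monomials, in Mathlib's idiom
  `Ideal.span ((fun s ↦ monomial s 1) '' S)` of `Mathlib/RingTheory/MvPolynomial/Ideal.lean`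
  (`mem_ideal_span_monomial_image`); API `isMonomial_span_monomial_image`, `isMonomial_span_X_image` (ideals
  generated by a set of variables — the primes of coordinate subspaces), `isMonomial_top`, `isMonomial_bot`.
* `HerzogHibiTrung2007_Cor2_2` — NAMED FACT, Cor. 2.2 as printed (`d` a POSITIVE integer, as `A^{(d)}` is only
  defined for those; `k ≥ 1` as printed).

Use (HIRONAKA campaign, L-rung W3.6, supply lemma T-B `VeroneseOfMonomialCut_ours` of
`Summits/…/MarkedTransferCampaignW36SupplyLemmas.lean`): for a closed set which is locally a reduced union of
coordinate subspaces of a regular system of parameters, the primes of the components are extended from the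
monomial primes `(X_i : i ∈ S)` along the flat map `K[X] → 𝒪_{Z,z}` (`RegularSequencePolynomialFlat.lean`), and
Cor. 2.2 gives the Veronese level `b₀ = d`; Remark 2.4 is the campaign's specimen (B) (three concurrent lines,
`b₀ = 2`). See HOME/L/res-lit-2/PLACEMENT-W36.md of that campaign. No statement of [Hironaka2017] is involved.

## Sources

* J. Herzog, T. Hibi, N. V. Trung, Adv. Math. 210 (2007) 304–322, doi 10.1016/j.aim.2006.06.007,
  arXiv math/0512423: Thm. 1.1, Cor. 1.2, Cor. 1.3, Thm. 2.1, Cor. 2.2, Rem. 2.4, Thm. 3.2. [HerzogHibiTrung2007]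
* G. Lyubeznik, *On the arithmetical rank of monomial ideals*, J. Algebra 112 (1988) 86–89 (squarefree case; not held).
-/

namespace Literature.RingTheory.MvPolynomial

universe u v

open _root_.MvPolynomial

section IsMonomial

variable {σ : Type u} {R : Type v} [CommSemiring R]

/-- **Monomial ideal**: an ideal of the polynomial ring `R[X_i : i ∈ σ]` generated by monomials `X^s`, written in
Mathlib's idiom `Ideal.span ((fun s ↦ monomial s 1) '' S)` (`MvPolynomial.mem_ideal_span_monomial_image`
characterises membership by supports) — the «monomial ideals I_1, …, I_r ⊂ S = K[x_1, …, x_n]» of the source.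
[cite: HerzogHibiTrung2007, §1 Cor. 1.3 / §2 Cor. 2.2 (notion «monomial ideal»)] -/
def IsMonomial (I : Ideal (MvPolynomial σ R)) : Prop :=
  ∃ S : Set (σ →₀ ℕ), I = Ideal.span ((fun s => monomial s (1 : R)) '' S)

/-- Unfolding of `IsMonomial`. [cite: HerzogHibiTrung2007, §1 Cor. 1.3 (notion «monomial ideal»)] -/
theorem isMonomial_iff (I : Ideal (MvPolynomial σ R)) :
    IsMonomial I ↔ ∃ S : Set (σ →₀ ℕ), I = Ideal.span ((fun s => monomial s (1 : R)) '' S) :=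
  Iff.rfl

/-- An ideal spanned by monomials is a monomial ideal. [cite: HerzogHibiTrung2007, §1 Cor. 1.3 (notion «monomial ideal»)] -/
theorem isMonomial_span_monomial_image (S : Set (σ →₀ ℕ)) :
    IsMonomial (Ideal.span ((fun s => monomial s (1 : R)) '' S)) :=
  ⟨S, rfl⟩

/-- The ideal generated by a set of variables `(X_i : i ∈ T)` — the ideal of a coordinate subspace — is a monomial
ideal (the primes `(x, y)`, `(y, z)`, `(x, z)` of Remark 2.4). [cite: HerzogHibiTrung2007, §2 Rem. 2.4 (notion «monomial ideal»)] -/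
theorem isMonomial_span_X_image (T : Set σ) :
    IsMonomial (Ideal.span (X '' T) : Ideal (MvPolynomial σ R)) :=
  ⟨(fun i => Finsupp.single i 1) '' T, by rw [Set.image_image]; rfl⟩

/-- The unit ideal is monomial (`1 = X^0`). [cite: HerzogHibiTrung2007, §1 Cor. 1.3 (notion «monomial ideal»)] -/
theorem isMonomial_top : IsMonomial (⊤ : Ideal (MvPolynomial σ R)) := by
  refine ⟨{0}, ?_⟩
  rw [Set.image_singleton, eq_comm, Ideal.span_singleton_eq_top]
  exact ⟨⟨monomial 0 1, monomial 0 1, by simp, by simp⟩, rfl⟩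

/-- The zero ideal is monomial (empty generating set). [cite: HerzogHibiTrung2007, §1 Cor. 1.3 (notion «monomial ideal»)] -/
theorem isMonomial_bot : IsMonomial (⊥ : Ideal (MvPolynomial σ R)) :=
  ⟨∅, by rw [Set.image_empty, Ideal.span_empty]⟩

/-- A member of a monomial ideal has every monomial of its support dominating a generator (Mathlib's support
criterion, restated for `IsMonomial`). [cite: HerzogHibiTrung2007, §1 Cor. 1.3 (notion «monomial ideal»)] -/
theorem IsMonomial.exists_le_of_mem_support {I : Ideal (MvPolynomial σ R)} (hI : IsMonomial I)
    {x : MvPolynomial σ R} (hx : x ∈ I) :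
    ∃ S : Set (σ →₀ ℕ), I = Ideal.span ((fun s => monomial s (1 : R)) '' S) ∧
      ∀ xi ∈ x.support, ∃ si ∈ S, si ≤ xi := by
  obtain ⟨S, rfl⟩ := hI
  exact ⟨S, rfl, mem_ideal_span_monomial_image.mp hx⟩

end IsMonomial

/-- NAMED FACT — **Herzog–Hibi–Trung 2007, Corollary 2.2**: "Let `I_1, …, I_r ⊂ S` be monomial ideals
[`S = K[x_1, …, x_n]`, `K` a field]. Then there exists an integer `d` such that `(⋂_{j=1}^r I_j^d)^k = ⋂_{j=1}^r I_j^{dk}`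
for all `k ≥ 1`." — `d` positive (the Veronese subalgebra `A^{(d)}` of `A = ⊕_k (⋂_j I_j^k) t^k` is defined for
positive `d`, §2; `A^{(d)}` standard graded, Thm. 2.1 (b), from the finite generation of `A`, Cor. 1.3). Rendered
with `S = MvPolynomial (Fin n) K` and the ideals indexed by `Fin r`. Users take `(h : HerzogHibiTrung2007_Cor2_2)`.
[cite: HerzogHibiTrung2007, Cor. 2.2] -/
def HerzogHibiTrung2007_Cor2_2 : Prop :=
  ∀ (K : Type u) [Field K] (n r : ℕ) (I : Fin r → Ideal (MvPolynomial (Fin n) K)),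
    (∀ j, IsMonomial (I j)) →
      ∃ d : ℕ, 0 < d ∧ ∀ k : ℕ, 0 < k → (⨅ j, I j ^ d) ^ k = ⨅ j, I j ^ (d * k)

namespace HerzogHibiTrung2007_Cor2_2

/-- **Cor. 2.2 for all `k`**: the case `k = 0` reads `⊤ = ⊤`, so the printed restriction `k ≥ 1` can be dropped.
PROVED from the fact. [cite: HerzogHibiTrung2007, Cor. 2.2] -/
theorem forall_pow_eq (h : HerzogHibiTrung2007_Cor2_2.{u}) (K : Type u) [Field K] (n r : ℕ)
    (I : Fin r → Ideal (MvPolynomial (Fin n) K)) (hI : ∀ j, IsMonomial (I j)) :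
    ∃ d : ℕ, 0 < d ∧ ∀ k : ℕ, (⨅ j, I j ^ d) ^ k = ⨅ j, I j ^ (d * k) := by
  obtain ⟨d, hd, hk⟩ := h K n r I hI
  refine ⟨d, hd, fun k => ?_⟩
  rcases Nat.eq_zero_or_pos k with rfl | hk0
  · simp only [pow_zero, mul_zero, Ideal.one_eq_top]
    exact (iInf_eq_top.mpr fun _ => rfl).symm
  · exact hk k hk0

/-- **Cor. 2.2, containment form used by Veronese arguments**: `⋂_j I_j^{dk} ≤ (⋂_j I_j^d)^k` for all `k` (the
reverse containment always holds). PROVED from the fact. [cite: HerzogHibiTrung2007, Cor. 2.2] -/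
theorem iInf_pow_mul_le (h : HerzogHibiTrung2007_Cor2_2.{u}) (K : Type u) [Field K] (n r : ℕ)
    (I : Fin r → Ideal (MvPolynomial (Fin n) K)) (hI : ∀ j, IsMonomial (I j)) :
    ∃ d : ℕ, 0 < d ∧ ∀ k : ℕ, ⨅ j, I j ^ (d * k) ≤ (⨅ j, I j ^ d) ^ k := by
  obtain ⟨d, hd, hk⟩ := forall_pow_eq h K n r I hI
  exact ⟨d, hd, fun k => (hk k).symm.le⟩

end HerzogHibiTrung2007_Cor2_2

/-- The containment `(⋂_j I_j^d)^k ≤ ⋂_j I_j^{dk}` holds for ALL ideals of any commutative semiring (no monomial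
hypothesis, no fact) — the trivial half of Cor. 2.2. [cite: HerzogHibiTrung2007, Cor. 2.2 (trivial containment)] -/
theorem iInf_pow_pow_le {A : Type u} [CommSemiring A] {ι : Type v} (I : ι → Ideal A) (d k : ℕ) :
    (⨅ j, I j ^ d) ^ k ≤ ⨅ j, I j ^ (d * k) := by
  refine le_iInf fun j => ?_
  rw [pow_mul]
  exact Ideal.pow_right_mono (iInf_le _ j) k

end Literature.RingTheory.MvPolynomial
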